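import Summits.Ventures.PercRepro.ThetaMultiWeakStep

/-!
# (Θ_∞): the Weak Split Lemma implies the conjecture

Dossier proofs/MINE1-theoremS.md, Addendum 76 suppl. 1 (mine-1, gen 39). With the weak split step
of ThetaMultiWeakStep.lean the Split Lemma of Addenda 73–75 takes its final form, **the Weak Split
Lemma** (`MultiWeakSplit α`): *every valid instance on a nonempty ground set `U` has a point
`e ∈ U` and a valid sub-labelling `T` of its projection (`T i ⊆ projE e A i`) whose partner pairs
are paid by the credit, `∑ᵢ |projE e A i| + ∑ᵢ |partE e A i| ≤ ∑ᵢ |T i| + |creditE U e A|`.*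
Nothing is asked of the partner family. Census (Addendum 76 suppl. 1): the lemma holds for every
one of the 95,733 instances on 5 points at which the strong split of Addendum 73 failed at every
point, for every labelled family on 4 points (2,434,112 instances) and — kit j313165 — on 5 points
with `k ≤ 6`.

* `sum_card_eq_zero_of_multiValidRel_empty` — on the empty ground set a valid instance is empty;
* `multiValidRel_sum_card_le_of_weakSplit` — **the Weak Split Lemma implies (Θ_∞) relative to
  every ground set** (induction on the ground set);
* `conjThetaMulti_of_weakSplit` — hence `ConjThetaMulti α`.
-/

namespace PercRepro.MSTight

open Finset

variable {α : Type*} [DecidableEq α] [Fintype α]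

/-- **The Weak Split Lemma**: every valid instance on a nonempty ground set has a point and a valid
sub-labelling of its projection whose partner pairs are paid by the credit. -/
def MultiWeakSplit (α : Type*) [DecidableEq α] [Fintype α] : Prop :=
  ∀ (U : Finset α) (m : ℕ) (A : Fin m → Finset (Finset α)), MultiValidRel U A → U.Nonempty →
    ∃ e ∈ U, ∃ T : Fin m → Finset (Finset α), (∀ i, T i ⊆ projE e A i) ∧
      MultiValidRel (U.erase e) T ∧
      ∑ i, (projE e A i).card + ∑ i, (partE e A i).card ≤ ∑ i, (T i).card + (creditE U e A).card

omit [Fintype α] in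
/-- On the empty ground set every valid instance is empty. -/
theorem sum_card_eq_zero_of_multiValidRel_empty {ι : Type*} [DecidableEq ι] [Fintype ι]
    {A : ι → Finset (Finset α)} (hv : MultiValidRel ∅ A) : ∑ i, (A i).card = 0 := by
  refine Finset.sum_eq_zero fun i _ => ?_
  rw [card_eq_zero, eq_empty_iff_forall_notMem]
  intro x hx
  have hx0 : x = ∅ := subset_empty.1 (hv.1 i x hx)
  subst hx0
  exact disjoint_left.1 (hv.2.1 i) hx (mem_complsRel.2 ⟨∅, hx, by simp⟩)

/-- **The Weak Split Lemma implies (Θ_∞) relative to every ground set.** -/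
theorem multiValidRel_sum_card_le_of_weakSplit (h : MultiWeakSplit α) :
    ∀ (U : Finset α) (m : ℕ) (A : Fin m → Finset (Finset α)), MultiValidRel U A →
      ∑ i, (A i).card ≤ (multiDRel U A).card := by
  intro U
  induction U using Finset.strongInduction with
  | H U ih =>
    intro m A hv
    rcases U.eq_empty_or_nonempty with rfl | hne
    · rw [sum_card_eq_zero_of_multiValidRel_empty hv]
      exact Nat.zero_le _
    · obtain ⟨e, he, T, hT, hTv, hK⟩ := h U m A hv hne
      exact sum_card_le_card_multiDRel_of_subset_projE hT (ih (U.erase e) (erase_ssubset he) m T hTv)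
        hK

/-- **The Weak Split Lemma implies Conjecture (Θ_∞).** -/
theorem conjThetaMulti_of_weakSplit (h : MultiWeakSplit α) : ConjThetaMulti α := by
  intro m A hv
  rw [← multiDRel_univ]
  exact multiValidRel_sum_card_le_of_weakSplit h univ m A ((multiValidRel_univ A).2 hv)

end PercRepro.MSTight
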